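import Literature.Probability.Percolation.VerticalTransport
import Literature.Probability.Percolation.TrackExchangeCleanAS
import HarnessLib

/-!
# Transport of vertical crossings (GM14 Proposition 6.8) — II: the process and its record heights

Grimmett–Manolescu, *Bond percolation on isoradial graphs* (PTRF 159 (2014) 273–327 =
arXiv:1204.0505), §6.3: "Let `ω^0` be a configuration on `G^0 := G_{α,β̃}` chosen according to its
canonical measure `P_{α,β̃}`, and let `G^k = V_{k-1} ∘ ⋯ ∘ V_0(G_{α,β̃})`, `ω^k = V_{k-1} ∘ ⋯ ∘ V_0(ω^0)`,
`D^k = {v_{x,y} : |x| ≤ N + 2k + y, 0 ≤ y ≤ 2N}`, `h^k = sup{h ≤ N : ∃ x₁, x₂ with v_{x₁,0} ↔ v_{x₂,h} in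
D^k, ω^k}`. […] The law `P` of the sequence `(ω^k)` is a combination of the law of `ω^0` with those
of the star–triangle transformations comprising the `V_k`."

On top of `VerticalTransport` (the exchange data `Dt t` and one-step laws `map_stepV` of the `N²`
exchanges) this file builds the process and proves the three hypotheses of the tail bound of
`ChainTailBound` for its record heights:

* `VData.P` — the law of (initial configuration, all the randomness): `P_{weightsT 0} ⊗ ν^{⊗ N²}`;
  `VData.cfgAt x t` — the configuration before exchange `t` (`t ≤ N²`), `cfgAt_succ`;
  **`map_cfgAt_prodMk`** (the configuration before exchange `t` and the randomness of exchange `t`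
  are independent with laws `P_t`, `ν`) and **`map_cfgAt_final`** (the final configuration has law
  `P_{N²}`), from `RandomMapChain.map_before_prodMk` / `map_chain`;
* `VData.DomT t = Dom (N + 2⌊t/N⌋) (level t)` (GM14's `D^k_j`, (6.30)), `VData.G t` — **the record
  height `h^k_j`** before exchange `t` (`hRec` of `VerticalSweep`, cap `N`), `measurable_G`;
* the deterministic inequalities along the process, for clean initial configurations
  (`clean_cfgAt`): `G_succ_ge` (GM14 (6.32)–(6.33): `G (t+1) + 1 ≥ G t`, and `G (t+1) ≥ G t` unless
  `G t = level t`), whence the null-set forms `measure_drop_eq_zero`, `measure_keep_eq_zero` used by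
  the tail bound (clean configurations have full measure, `TrackExchangeCleanAS`).

The probabilistic hypothesis (GM14 (6.34)) and the conclusion are in the sequel.

## References

* G. R. Grimmett, I. Manolescu, PTRF 159 (2014) 273–327, arXiv:1204.0505, §6.3 (the process
  `ω^k`, the trapezia `D^k`, `D^k_j` (6.30), the heights `h^k`, `h^k_j`, (6.32)–(6.33)).
-/

noncomputable section

namespace Literature.Probability.Percolation

open LatticeModels StarTriangle Real MeasureTheory

namespace TrackExchange

/-- The record is monotone in the domain. [folklore] -/
theorem hRec_mono {S S' : Set (ℤ × ℤ)} (hS : S ⊆ S') {N : ℕ} {ω : Set (Sym2 SV)} (h0 : Reaches S ω 0) :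
    hRec S N ω ≤ hRec S' N ω :=
  le_hRec (hRec_le h0) (reaches_mono hS (reaches_hRec h0))

/-- A chain of length zero does nothing (length given propositionally). [folklore] -/
theorem chain_of_eq_zero {A S : Type*} : ∀ {n : ℕ} (f : Fin n → A → S → A) (a : A) (u : Fin n → S),
    n = 0 → RandomMapChain.chain n f a u = a
  | 0, _, _, _, _ => rfl
  | n + 1, _, _, _, h => (Nat.succ_ne_zero n h).elim

/-- The final state is the last map applied to the state before the last step (length given
propositionally). [folklore] -/
theorem chain_eq_step_before' {A S : Type*} : ∀ {m : ℕ} (f : Fin m → A → S → A) (a : A) (u : Fin m → S)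
    (t : ℕ) (ht : t + 1 = m),
    RandomMapChain.chain m f a u = f ⟨t, by omega⟩ (RandomMapChain.before m f a u ⟨t, by omega⟩) (u ⟨t, by omega⟩)
  | m + 1, f, a, u, t, ht => by
    have : t = m := by omega
    subst this
    exact RandomMapChain.chain_eq_step_before t f a u

namespace VData

variable (V : VData)

/-! ### The process -/

/-- The sample space: an initial configuration and the randomness of the `N²` exchanges. [folklore] -/
abbrev Ω : Type := Set (Sym2 SV) × (Fin (V.N * V.N) → V.Noise)

/-- The law of the configuration at time `t`: `P_{weightsT t}`. [cite: GrimmettManolescu2014Isoradial, §6.3] -/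
def μt (t : ℕ) : Measure (Set (Sym2 SV)) := prodBernoulli (V.weightsT t)

/-- `μt t` is a probability measure. [folklore] -/
instance (t : ℕ) : IsProbabilityMeasure (V.μt t) := by unfold μt; infer_instance

/-- **The law `P`** of the initial configuration and of all the randomness. [cite: GrimmettManolescu2014Isoradial, §6.3] -/
def P : Measure V.Ω := (V.μt 0).prod (Measure.pi fun _ : Fin (V.N * V.N) => V.ν)

/-- `P` is a probability measure. [folklore] -/
instance : IsProbabilityMeasure V.P := by unfold P; infer_instance

/-- The exchanges as a `Fin`-indexed family of random maps. [folklore] -/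
def steps : Fin (V.N * V.N) → Set (Sym2 SV) → V.Noise → Set (Sym2 SV) := fun t => V.stepV t

/-- **The configuration before exchange `t`** (`t ≤ N²`; the final configuration for `t ≥ N²`):
GM14's `ω^k_j`. [cite: GrimmettManolescu2014Isoradial, §6.3] -/
def cfgAt (x : V.Ω) (t : ℕ) : Set (Sym2 SV) :=
  if h : t < V.N * V.N then RandomMapChain.before (V.N * V.N) V.steps x.1 x.2 ⟨t, h⟩
  else RandomMapChain.chain (V.N * V.N) V.steps x.1 x.2

/-- Before the first exchange the configuration is the initial one. [folklore] -/
theorem cfgAt_zero (x : V.Ω) : V.cfgAt x 0 = x.1 := by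
  unfold cfgAt
  split_ifs with h
  · rfl
  · exact chain_of_eq_zero _ _ _ (by omega)

/-- **One more exchange.** [cite: GrimmettManolescu2014Isoradial, §6.3] -/
theorem cfgAt_succ (x : V.Ω) {t : ℕ} (ht : t < V.N * V.N) :
    V.cfgAt x (t + 1) = V.stepV t (V.cfgAt x t) (x.2 ⟨t, ht⟩) := by
  unfold cfgAt
  rw [dif_pos ht]
  by_cases h : t + 1 < V.N * V.N
  · rw [dif_pos h, RandomMapChain.before_val_succ]
    rfl
  · rw [dif_neg h]
    exact chain_eq_step_before' _ _ _ t (by omega)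

/-- The configuration before exchange `t` is a measurable function of the sample. [folklore] -/
theorem measurable_cfgAt (t : ℕ) : Measurable fun x : V.Ω => V.cfgAt x t := by
  unfold cfgAt
  split_ifs with h
  · exact RandomMapChain.measurable_before _ _ (fun k => V.measurable_stepV k) ⟨t, h⟩
  · exact RandomMapChain.measurable_chain _ _ (fun k => V.measurable_stepV k) |>.comp
      (measurable_fst.prodMk measurable_snd)

/-- **The pair law**: the configuration before exchange `t` and the randomness of exchange `t` are
independent, with laws `P_t` and `ν` ("the marginal law of `ω^k` under `P` is `P_{G^k}`", and the
randomness of the next exchange is fresh). [cite: GrimmettManolescu2014Isoradial, §6.3] -/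
theorem map_cfgAt_prodMk {ε : ℝ} (hV : V.Valid ε) {t : ℕ} (ht : t < V.N * V.N) :
    V.P.map (fun x => (V.cfgAt x t, x.2 ⟨t, ht⟩)) = (V.μt t).prod V.ν := by
  have key := RandomMapChain.map_before_prodMk V.ν (V.N * V.N) V.steps (fun k => V.measurable_stepV k)
    (fun i : Fin (V.N * V.N + 1) => V.μt i) (fun k => ?_) ⟨t, ht⟩
  · have hfun : (fun x : V.Ω => (V.cfgAt x t, x.2 ⟨t, ht⟩)) =
        fun x => (RandomMapChain.before (V.N * V.N) V.steps x.1 x.2 ⟨t, ht⟩, x.2 ⟨t, ht⟩) := by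
      funext x; unfold cfgAt; rw [dif_pos ht]
    rw [hfun]
    exact key
  · exact map_stepV hV k.2

/-- **The law of the final configuration** is `P_{N²}` — the canonical measure with the irregular
angles `β_0, …, β_{N-1}` on the levels `0, …, N-1`. [cite: GrimmettManolescu2014Isoradial, §6.3] -/
theorem map_cfgAt_final {ε : ℝ} (hV : V.Valid ε) :
    V.P.map (fun x => V.cfgAt x (V.N * V.N)) = V.μt (V.N * V.N) := by
  have key := RandomMapChain.map_chain V.ν (V.N * V.N) V.steps (fun k => V.measurable_stepV k)
    (fun i : Fin (V.N * V.N + 1) => V.μt i) (fun k => map_stepV hV k.2)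
  have hfun : (fun x : V.Ω => V.cfgAt x (V.N * V.N)) = fun x => RandomMapChain.chain (V.N * V.N) V.steps x.1 x.2 := by
    funext x; unfold cfgAt; rw [dif_neg (lt_irrefl _)]
  rw [hfun]
  exact key

/-- The law of the initial configuration is `P_0`. [folklore] -/
theorem map_cfgAt_zero : V.P.map (fun x => V.cfgAt x 0) = V.μt 0 := by
  have hfun : (fun x : V.Ω => V.cfgAt x 0) = Prod.fst := by funext x; exact V.cfgAt_zero x
  rw [hfun, P, Measure.map_fst_prod, measure_univ, one_smul]

/-! ### Domains and record heights -/

/-- The constant of the trapezium at time `t`: `N + 2k`. [cite: GrimmettManolescu2014Isoradial, §6.3] -/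
def cT (t : ℕ) : ℤ := (V.N : ℤ) + 2 * ((t / V.N : ℕ) : ℤ)

/-- The upper level of exchange `t`. [cite: GrimmettManolescu2014Isoradial, §6.3] -/
def ℓT (t : ℕ) : ℤ := V.level (t / V.N) (t % V.N)

/-- `ℓT t` is the level of the exchange data at time `t`. [folklore] -/
theorem Dt_j (t : ℕ) : (V.Dt t).j = V.ℓT t := rfl

/-- **The trapezium before exchange `t`** (GM14's `D^k_j`, (6.30)). [cite: GrimmettManolescu2014Isoradial, §6.3 (6.30)] -/
def DomT (t : ℕ) : Set (ℤ × ℤ) := Dom (V.cT t) (V.ℓT t)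

/-- The origin is in every trapezium. [folklore] -/
theorem zero_mem_DomT (t : ℕ) : ((0 : ℤ), (0 : ℤ)) ∈ V.DomT t := by
  refine ⟨le_rfl, ?_⟩
  simp only [abs_zero, cT]
  split_ifs <;> positivity

/-- **The trapezium after exchange `t` is contained in the trapezium before exchange `t + 1`**
(equal within a block; GM14's `D^k_{2N-k} ⊆ D^{k+1}` across blocks). [cite: GrimmettManolescu2014Isoradial, §6.3] -/
theorem Dom_succ_subset_DomT {t : ℕ} (ht : t < V.N * V.N) : Dom (V.cT t) (V.ℓT t + 1) ⊆ V.DomT (t + 1) := by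
  have hN : 0 < V.N := Nat.pos_of_ne_zero fun h => by rw [h] at ht; simp at ht
  unfold DomT cT ℓT level
  by_cases h : t % V.N + 1 < V.N
  · have h2 : (t + 1) % V.N = t % V.N + 1 := by
      rw [Nat.add_mod, Nat.one_mod_eq_one.mpr (by omega)]
      exact Nat.mod_eq_of_lt h
    have h1 : (t + 1) / V.N = t / V.N := by
      rw [Nat.succ_div, if_neg (fun hd => ?_), Nat.add_zero]
      have := Nat.mod_eq_zero_of_dvd hd
      omega
    rw [h1, h2]
    exact Dom_mono (by push_cast; omega)
  · have hs : t % V.N < V.N := Nat.mod_lt _ hN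
    have hdvd : V.N ∣ t + 1 := by
      have := Nat.div_add_mod t V.N
      exact ⟨t / V.N + 1, by rw [Nat.mul_add, mul_one]; omega⟩
    have h1 : (t + 1) / V.N = t / V.N + 1 := by rw [Nat.succ_div, if_pos hdvd]
    have h2 : (t + 1) % V.N = 0 := Nat.mod_eq_zero_of_dvd hdvd
    rw [h1, h2]
    have e : (V.N : ℤ) + 2 * ((t / V.N + 1 : ℕ) : ℤ) = (V.N : ℤ) + 2 * ((t / V.N : ℕ) : ℤ) + 2 := by push_cast; ring
    rw [e]
    exact Dom_subset_Dom_add_two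

/-- **The record height before exchange `t`** (GM14's `h^k_j`, cap `N`). [cite: GrimmettManolescu2014Isoradial, §6.3] -/
def G (t : ℕ) (x : V.Ω) : ℕ := hRec (V.DomT t) V.N (V.cfgAt x t)

/-- The record height is a measurable function of the sample. [folklore] -/
theorem measurable_G (t : ℕ) : Measurable (V.G t) := (measurable_hRec _ _).comp (V.measurable_cfgAt t)

/-- The record height is at most `N`. [folklore] -/
theorem G_le (t : ℕ) (x : V.Ω) : V.G t x ≤ V.N := hRec_le (reaches_zero (V.zero_mem_DomT t))

/-! ### Deterministic inequalities along the process -/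

variable {V}

/-- **Clean in, clean throughout.** [cite: GrimmettManolescu2014Isoradial, §6.3] -/
theorem clean_cfgAt {ε : ℝ} (hV : V.Valid ε) {x : V.Ω} (hx : Clean (V.weightsT 0) x.1) :
    ∀ t, t ≤ V.N * V.N → Clean (V.weightsT t) (V.cfgAt x t)
  | 0, _ => by rw [cfgAt_zero]; exact hx
  | t + 1, ht => by
    have ih := clean_cfgAt hV hx t (by omega)
    rw [V.cfgAt_succ x (by omega : t < V.N * V.N), ← V.exchanged_Dt (by omega)]
    exact ExchangeData.clean_sweep₂ (Dt_valid₂ hV t) ih _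

/-- Bounds on the constants along the process. [folklore] -/
theorem cT_le {t : ℕ} (ht : t ≤ V.N * V.N) : V.cT t ≤ 3 * V.N := by
  unfold cT
  rcases Nat.eq_zero_or_pos V.N with hN | hN
  · simp [hN]
  · have : t / V.N ≤ V.N := Nat.div_le_of_le_mul (by linarith)
    push_cast; omega

/-- The levels of the exchanges are at least `1`. [folklore] -/
theorem one_le_ℓT {t : ℕ} (ht : t < V.N * V.N) : 1 ≤ V.ℓT t := by
  have hN : 0 < V.N := Nat.pos_of_ne_zero fun h => by rw [h] at ht; simp at ht
  have : t / V.N < V.N := Nat.div_lt_of_lt_mul ht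
  unfold ℓT level
  omega

/-- **GM14 (6.32)–(6.33) along the process**: for a clean initial configuration and a strip of
half-width `M ≥ 4N + 4`, the record drops by at most one at each exchange, and does not drop
unless it equals the level of the exchange. [cite: GrimmettManolescu2014Isoradial, §6.3 (6.32)–(6.33)] -/
theorem G_succ_ge {ε : ℝ} (hV : V.Valid ε) (hM : 4 * V.N + 4 ≤ V.M) {x : V.Ω} (hx : Clean (V.weightsT 0) x.1)
    {t : ℕ} (ht : t < V.N * V.N) :
    ((V.G t x : ℤ) ≠ V.ℓT t → V.G t x ≤ V.G (t + 1) x) ∧ V.G t x ≤ V.G (t + 1) x + 1 := by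
  have hclean : Clean (V.Dt t).initial (V.cfgAt x t) := clean_cfgAt hV hx t ht.le
  have hc0 : 0 ≤ V.cT t := by unfold cT; positivity
  have hwide : V.cT t + V.N + 4 ≤ (V.Dt t).M := by
    have := cT_le (V := V) ht.le
    show V.cT t + V.N + 4 ≤ V.M
    omega
  have key := ExchangeData.hRec_sweep₂_ge (Dt_valid₂ hV t) hclean (c := V.cT t) (N := V.N) hc0 hwide
    (by rw [Dt_j]; exact one_le_ℓT ht) (x.2 ⟨t, ht⟩)
  rw [Dt_j] at key
  -- the record at time `t + 1` is taken in a larger trapezium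
  have hmono : hRec (Dom (V.cT t) (V.ℓT t + 1)) V.N ((V.Dt t).sweep₂ (V.cfgAt x t) (x.2 ⟨t, ht⟩)) ≤ V.G (t + 1) x := by
    unfold G
    rw [V.cfgAt_succ x ht]
    refine hRec_mono (Dom_succ_subset_DomT (V := V) ht) (reaches_zero (m := 0) ⟨le_rfl, ?_⟩)
    simp only [abs_zero]; split_ifs <;> omega
  exact ⟨fun h => (key.1 h).trans hmono, key.2.trans (Nat.add_le_add_right hmono 1)⟩

/-- The drop inequality fails only off the clean configurations, a null set. [folklore] -/
theorem measure_drop_eq_zero {ε : ℝ} (hV : V.Valid ε) (hM : 4 * V.N + 4 ≤ V.M) {t : ℕ} (ht : t < V.N * V.N) :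
    V.P {x | V.G (t + 1) x + 1 < V.G t x} = 0 := by
  refine measure_mono_null (t := Prod.fst ⁻¹' {ω | ¬ Clean (V.weightsT 0) ω}) (fun x hx => ?_) ?_
  · intro hc
    have := (G_succ_ge hV hM hc ht).2
    simp only [Set.mem_setOf_eq] at hx
    omega
  · have : (Prod.fst ⁻¹' {ω | ¬ Clean (V.weightsT 0) ω} : Set V.Ω) = {ω | ¬ Clean (V.weightsT 0) ω} ×ˢ Set.univ := by
      ext x; simp
    rw [this, P, Measure.prod_prod, μt, prodBernoulli_setOf_not_clean, zero_mul]

/-- The keep inequality fails only off the clean configurations, a null set. [folklore] -/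
theorem measure_keep_eq_zero {ε : ℝ} (hV : V.Valid ε) (hM : 4 * V.N + 4 ≤ V.M) {t : ℕ} (ht : t < V.N * V.N) :
    V.P {x | V.G t x ≠ (V.ℓT t).toNat ∧ V.G (t + 1) x < V.G t x} = 0 := by
  refine measure_mono_null (t := Prod.fst ⁻¹' {ω | ¬ Clean (V.weightsT 0) ω}) (fun x hx => ?_) ?_
  · intro hc
    have h1 := (G_succ_ge hV hM hc ht).1
    have hℓ := one_le_ℓT (V := V) ht
    simp only [Set.mem_setOf_eq] at hx
    have : (V.G t x : ℤ) ≠ V.ℓT t := fun h => hx.1 (by omega)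
    have := h1 this
    omega
  · have : (Prod.fst ⁻¹' {ω | ¬ Clean (V.weightsT 0) ω} : Set V.Ω) = {ω | ¬ Clean (V.weightsT 0) ω} ×ˢ Set.univ := by
      ext x; simp
    rw [this, P, Measure.prod_prod, μt, prodBernoulli_setOf_not_clean, zero_mul]

end VData

end TrackExchange

end Literature.Probability.Percolation
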